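import Summits.Ventures.Crystal3D.Theorems.StickyWulffConstantCoaxialWallLawBarlowWindowHeights
import Summits.Ventures.Crystal3D.Theorems.StickyWulffConstantCoaxialWallLawOnSiteLocality
import HarnessLib

/-!
# Twin readings on a Barlow window: the normal is the basal axis and the far slots are never sites
# (crux `CoaxialWallLaw`, stmt-Ventures-19481, line `WallLedgerF`; discharge of the outer-shell lemma's far-slot hypothesis)

HONEST FRAMING. Venture `Summits/Ventures/Crystal3D` (cell `crystal3d-full`), helper `--supports` the crux
`CoaxialWallLaw` (stmt-Ventures-19481, `route-Ventures-StickyWulffConstant`), REGISTERED line `WallLedgerF` (planner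
cf-p1).  Rung credit; F-C1 not moved; census-free.  cf-p1 DECISION (xlviii) (2026-08-28T22:38Z): the lane-F tail is
re-targeted through 19481-p1's OUTER-SHELL REDUCTION (`…EndRowOuterShell`, `localSummandA_le_localSummandFlat`; the
signature-row twin is `…EndRowOuterShellSig`), whose one non-trivial hypothesis `hfar` says that the FAR SLOTS of the twin
readings near the payer are not among the added outer-shell balls.  On a Barlow window this is a lattice fact, proved
here (asked of «the frame lemma file» = this seat):

* **`twinReading_normal_basal_barlow`** — on a Barlow window a TWIN-DOZEN reading `IsTwinReading X G m q` has `m = ±e₃`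
  (the mirror offset `2√(2/3)·m` is a difference of two neighbour-menu vectors, so `m₂ ∈ {0, ±½, ±1}`, while a menu
  normal of a standard dozen has `m₂ ∈ {±1, ±⅓}`, `modelNormal_apply_two`);
* **`far_slot_not_site_barlow`** — hence the three far slots `q + G w` (`⟪G w, m⟫ > 0`) of a twin reading on a Barlow
  window are NOT sites of the stacking (`sameLayer_purity`: the far slot lies in `G`'s dozen, the occupied mirror ball
  in the other): `hfar` holds for every superset of the window inside `Λ(s)`.
WHAT THIS IS NOT: not the outer-shell lemma, not the certificate; F-C1 not moved.
-/

noncomputable section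

namespace Summit.Ventures.Crystal3D.Theorems

open Summit.Ventures.Crystal3D Finset
open Literature.MathematicalPhysics.StatisticalMechanics (barlowPos barlowStacking fccStacking constHagg IsHaggSeq
  basalMirror basalMirror_apply_coord basalMirror_basalMirror barlowPos_apply_two)
open scoped InnerProductSpace

/-! ### Twin readings on a Barlow window have a basal normal -/

section Window

variable {s : ℤ → ℤ} (hs : IsHaggSeq s) {X : Finset (EuclideanSpace ℝ (Fin 3))} {q : EuclideanSpace ℝ (Fin 3)}
  (hq : q ∈ barlowStacking 1 (Real.sqrt (2 / 3)) s)
  (hX : ∀ x ∈ X, dist q x = 1 → x ∈ barlowStacking 1 (Real.sqrt (2 / 3)) s)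
include hs hq hX

/-- An occupied unit offset of `q` is a neighbour-menu vector. -/
theorem mem_neighbourMenu_of_occupied {y : EuclideanSpace ℝ (Fin 3)} (hy1 : ‖y‖ = 1) (hocc : q + y ∈ X) :
    y ∈ fccSlots ∨ y ∈ (basalMirror : EuclideanSpace ℝ (Fin 3) → EuclideanSpace ℝ (Fin 3)) '' ↑fccSlots := by
  have hd : dist q (q + y) = 1 := by rw [dist_eq_norm, sub_add_cancel_left, norm_neg, hy1]
  have := barlow_neighbour_mem hs hq (hX _ hocc hd) hd
  rwa [add_sub_cancel_left] at this

/-- **On a Barlow window every twin reading has normal `±e₃`.** -/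
theorem twinReading_normal_basal_barlow {G : EuclideanSpace ℝ (Fin 3) ≃ₗᵢ[ℝ] EuclideanSpace ℝ (Fin 3)}
    {m : EuclideanSpace ℝ (Fin 3)} (htr : IsTwinReading X G m q) :
    m = EuclideanSpace.single (2 : Fin 3) (1 : ℝ) ∨ m = -EuclideanSpace.single (2 : Fin 3) (1 : ℝ) := by
  classical
  have hr : 0 < Real.sqrt (2 / 3) := Real.sqrt_pos.2 (by norm_num)
  have hstd := frame_of_isTwinReading_barlow hs hq hX htr
  obtain ⟨⟨hm1, hmenu⟩, hown, hmir, -⟩ := htr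
  -- (1) `m₂ ∈ {±1, ±1/3}`: `m` is a menu normal of a standard dozen
  obtain ⟨ε, himg⟩ := exists_sigFrame_of_std hstd
  have hinv : ∀ x, sigFrame ε (sigFrame ε x) = x := by
    intro x; conv_lhs => rw [← sigFrame_symm_apply ε (sigFrame ε x)]; exact (sigFrame ε).symm_apply_apply x
  have hadj : ∀ x y, ⟪sigFrame ε x, y⟫_ℝ = ⟪x, sigFrame ε y⟫_ℝ := by
    intro x y; rw [← LinearIsometryEquiv.inner_map_map (sigFrame ε) x (sigFrame ε y), hinv]
  have hmenu' : ∀ w ∈ fccSlots, ⟪(sigFrame ε) w, m⟫_ℝ = 0 ∨ ⟪(sigFrame ε) w, m⟫_ℝ = Real.sqrt (2 / 3) ∨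
      ⟪(sigFrame ε) w, m⟫_ℝ = -Real.sqrt (2 / 3) := ((isMenuNormal_congr himg m).1 ⟨hm1, hmenu⟩).2
  have hnmenu : ∀ w ∈ fccSlots, ⟪w, sigFrame ε m⟫_ℝ = 0 ∨ ⟪w, sigFrame ε m⟫_ℝ = Real.sqrt (2 / 3) ∨
      ⟪w, sigFrame ε m⟫_ℝ = -Real.sqrt (2 / 3) := by
    intro w hw; rw [← hadj]; exact hmenu' w hw
  have hn1 : ‖sigFrame ε m‖ = 1 := by rw [LinearIsometryEquiv.norm_map, hm1]
  have hn2 := modelNormal_apply_two (mem_modelNormals_of_menu hn1 hnmenu)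
  have hm2 : m 2 = 1 ∨ m 2 = -1 ∨ m 2 = 1 / 3 ∨ m 2 = -(1 / 3) := by
    have hmn : m = sigFrame ε (sigFrame ε m) := (hinv m).symm
    cases ε with
    | false => exact hn2
    | true =>
      have e : m 2 = -((sigFrame true m) 2) := by
        conv_lhs => rw [hmn]
        change (basalMirror (sigFrame true m)) 2 = _
        rw [basalMirror_apply_coord]; simp
      rw [e]
      rcases hn2 with h | h | h | h <;> rw [h] <;> norm_num
  -- (2) `m₂ ∈ {0, ±1/2, ±1}`: the mirror offset is a difference of two neighbour-menu heights
  obtain ⟨a, ha, -, -, -, -, hna, -⟩ := exists_far_frame G hm1 hmenu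
  have ha1 : ‖G a‖ = 1 := by rw [LinearIsometryEquiv.norm_map, norm_eq_one_of_mem_fccSlots ha]
  have hna' : ⟪G (-a), m⟫_ℝ = -Real.sqrt (2 / 3) := by rw [map_neg, inner_neg_left, hna]
  have hlow : q + G (-a) ∈ X := hown (-a) (neg_mem_fccSlots ha) (by rw [hna']; linarith)
  have hmirr : q + (G (-a) - (2 * ⟪G (-a), m⟫_ℝ) • m) ∈ X := hmir (-a) (neg_mem_fccSlots ha) (by rw [hna']; linarith)
  have hf : -G a ∈ fccSlots ∨ -G a ∈ (basalMirror : EuclideanSpace ℝ (Fin 3) → EuclideanSpace ℝ (Fin 3)) '' ↑fccSlots := by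
    refine mem_neighbourMenu_of_occupied hs hq hX (by rw [norm_neg, ha1]) ?_
    rw [← map_neg]; exact hlow
  have hf' : -G a + (2 * Real.sqrt (2 / 3)) • m ∈ fccSlots ∨
      -G a + (2 * Real.sqrt (2 / 3)) • m ∈ (basalMirror : EuclideanSpace ℝ (Fin 3) → EuclideanSpace ℝ (Fin 3)) '' ↑fccSlots := by
    have hnorm := norm_reflectStep_slot G hm1 (neg_mem_fccSlots ha)
    have heq : G (-a) - (2 * ⟪G (-a), m⟫_ℝ) • m = -G a + (2 * Real.sqrt (2 / 3)) • m := by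
      rw [hna', map_neg]; module
    rw [heq] at hnorm hmirr
    exact mem_neighbourMenu_of_occupied hs hq hX hnorm hmirr
  have h1 := neighbourMenu_apply_two hf
  have h2 := neighbourMenu_apply_two hf'
  have e2 : (-G a + (2 * Real.sqrt (2 / 3)) • m) 2 = (-G a) 2 + 2 * Real.sqrt (2 / 3) * m 2 := by
    simp only [PiLp.add_apply, PiLp.smul_apply, smul_eq_mul]
  rw [e2] at h2
  -- (3) combine: `m₂ = ±1`, hence `m = ±e₃`
  have hm2' : m 2 = 1 ∨ m 2 = -1 := by
    rcases hm2 with h | h | h | h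
    · exact Or.inl h
    · exact Or.inr h
    · exfalso; rcases h1 with h1 | h1 | h1 <;> rcases h2 with h2 | h2 | h2 <;> rw [h1, h] at h2 <;> nlinarith [hr, h2]
    · exfalso; rcases h1 with h1 | h1 | h1 <;> rcases h2 with h2 | h2 | h2 <;> rw [h1, h] at h2 <;> nlinarith [hr, h2]
  have hnorm : m 0 ^ 2 + m 1 ^ 2 + m 2 ^ 2 = 1 := by
    have := hm1
    rw [EuclideanSpace.norm_eq, Real.sqrt_eq_one, Fin.sum_univ_three] at this
    simpa only [Real.norm_eq_abs, sq_abs] using this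
  have hm22 : m 2 ^ 2 = 1 := by rcases hm2' with h | h <;> rw [h] <;> norm_num
  have hm0 : m 0 = 0 := by nlinarith [sq_nonneg (m 0), sq_nonneg (m 1)]
  have hm1' : m 1 = 0 := by nlinarith [sq_nonneg (m 0), sq_nonneg (m 1)]
  rcases hm2' with h | h
  · left; ext i; fin_cases i <;> simp [hm0, hm1', h]
  · right; ext i; fin_cases i <;> simp [hm0, hm1', h]

end Window

section Far

variable {s : ℤ → ℤ} (hs : IsHaggSeq s) {X : Finset (EuclideanSpace ℝ (Fin 3))} {q : EuclideanSpace ℝ (Fin 3)}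
  (hq : q ∈ barlowStacking 1 (Real.sqrt (2 / 3)) s)
  (hX : ∀ x ∈ X, dist q x = 1 → x ∈ barlowStacking 1 (Real.sqrt (2 / 3)) s)
include hs hq hX

/-- **THE FAR SLOTS OF A TWIN READING ON A BARLOW WINDOW ARE NOT SITES.**  If `IsTwinReading X G m q` at a site `q`
whose occupied unit sphere lies on the stacking, then `q + G w ∉ Λ(s)` for every slot `w` with `⟪G w, m⟫ > 0`. -/
theorem far_slot_not_site_barlow {G : EuclideanSpace ℝ (Fin 3) ≃ₗᵢ[ℝ] EuclideanSpace ℝ (Fin 3)}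
    {m : EuclideanSpace ℝ (Fin 3)} (htr : IsTwinReading X G m q) {w : EuclideanSpace ℝ (Fin 3)} (hw : w ∈ fccSlots)
    (hpos : 0 < ⟪G w, m⟫_ℝ) : q + G w ∉ barlowStacking 1 (Real.sqrt (2 / 3)) s := by
  classical
  have hr : 0 < Real.sqrt (2 / 3) := Real.sqrt_pos.2 (by norm_num)
  have hmb := twinReading_normal_basal_barlow hs hq hX htr
  have hstd := frame_of_isTwinReading_barlow hs hq hX htr
  obtain ⟨⟨hm1, hmenu⟩, hown, hmir, -⟩ := htr
  intro hsite
  -- `⟪G w, m⟫ = √(2/3)`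
  have hfw : ⟪G w, m⟫_ℝ = Real.sqrt (2 / 3) := by
    rcases hmenu w hw with h | h | h
    · rw [h] at hpos; exact absurd hpos (lt_irrefl _)
    · exact h
    · rw [h] at hpos; linarith
  have hf1 : ‖G w‖ = 1 := by rw [LinearIsometryEquiv.norm_map, norm_eq_one_of_mem_fccSlots hw]
  -- `m = m₂ • e₃` with `m₂ = ±1`, and `⟪G w, e₃⟫ = m₂ √(2/3)`
  have hm2 : m 2 = 1 ∨ m 2 = -1 := by
    rcases hmb with h | h <;> rw [h]
    · left; simp
    · right; simp
  have hmE : m = (m 2) • EuclideanSpace.single (2 : Fin 3) (1 : ℝ) := by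
    rcases hmb with h | h
    · rw [h]; simp
    · rw [h]; ext i; fin_cases i <;> simp
  have hGwE : ⟪G w, EuclideanSpace.single (2 : Fin 3) (1 : ℝ)⟫_ℝ = m 2 * Real.sqrt (2 / 3) := by
    rcases hmb with h | h
    · have h2 : m 2 = 1 := by rw [h]; simp
      rw [← h, hfw, h2, one_mul]
    · have h2 : m 2 = -1 := by rw [h]; simp
      have : EuclideanSpace.single (2 : Fin 3) (1 : ℝ) = -m := by rw [h, neg_neg]
      rw [this, inner_neg_right, hfw, h2]; ring
  have hm22 : m 2 * m 2 = 1 := by rcases hm2 with h | h <;> rw [h] <;> norm_num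
  -- the opposite slot and its mirror ball are occupied
  have hna : ⟪G (-w), m⟫_ℝ = -Real.sqrt (2 / 3) := by rw [map_neg, inner_neg_left, hfw]
  have hmirr : q + (-G w + (2 * Real.sqrt (2 / 3)) • m) ∈ X := by
    have := hmir (-w) (neg_mem_fccSlots hw) (by rw [hna]; linarith)
    rw [hna, map_neg] at this
    rw [show -G w + (2 * Real.sqrt (2 / 3)) • m = -G w - (2 * -Real.sqrt (2 / 3)) • m by module]
    exact this
  have hxd : dist q (q + G w) = 1 := by rw [dist_eq_norm, sub_add_cancel_left, norm_neg, hf1]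
  have hx'd : dist q (q + (-G w + (2 * Real.sqrt (2 / 3)) • m)) = 1 := by
    have hnorm := norm_reflectStep_slot G hm1 (neg_mem_fccSlots hw)
    rw [hna, map_neg, show -G w - (2 * -Real.sqrt (2 / 3)) • m = -G w + (2 * Real.sqrt (2 / 3)) • m by module] at hnorm
    rw [dist_eq_norm, sub_add_cancel_left, norm_neg, hnorm]
  -- the mirror ball offset is the basal mirror image of `−G w`
  have hrefl : -G w + (2 * Real.sqrt (2 / 3)) • m = basalMirror (-G w) := by
    rw [basalMirror_apply_eq, inner_neg_left, hGwE]
    conv_lhs => rw [hmE]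
    rw [smul_smul]
    module
  -- heights agree and are nonzero
  have hGw2 : (G w) 2 = m 2 * Real.sqrt (2 / 3) := by rw [← inner_single_two_one, hGwE]
  have hM2 : (basalMirror (-G w)) 2 = m 2 * Real.sqrt (2 / 3) := by
    rw [basalMirror_apply_coord]; simp only [if_true]
    change -(-(G w) 2) = _
    rw [neg_neg, hGw2]
  have hne : (G w) 2 ≠ 0 := by
    rw [hGw2]; rcases hm2 with h | h <;> rw [h] <;> nlinarith [hr]
  rw [hrefl] at hmirr hx'd
  have hpur := sameLayer_purity hs hq hsite (hX _ hmirr hx'd) hxd hx'd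
    (by rw [add_sub_cancel_left, add_sub_cancel_left, hGw2, hM2]) (by rw [add_sub_cancel_left]; exact hne)
  rw [add_sub_cancel_left, add_sub_cancel_left] at hpur
  have hM2ne : (basalMirror (-G w)) 2 ≠ 0 := by rw [hM2, ← hGw2]; exact hne
  have hGw_img : G w ∈ (G : EuclideanSpace ℝ (Fin 3) → EuclideanSpace ℝ (Fin 3)) '' ↑fccSlots := ⟨w, mem_coe.2 hw, rfl⟩
  rcases hstd with hstd | hstd
  · -- `G`-dozen is `D₊`: the mirror offset `M(−G w)` is an off-plane vector of `D₋`, not a slot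
    rw [hstd] at hGw_img
    have hGwS : G w ∈ fccSlots := mem_coe.1 hGw_img
    have hM : basalMirror (-G w) ∈ (basalMirror : EuclideanSpace ℝ (Fin 3) → EuclideanSpace ℝ (Fin 3)) '' ↑fccSlots :=
      ⟨-G w, mem_coe.2 (neg_mem_fccSlots hGwS), rfl⟩
    have hnot := not_mem_fccSlots_of_offPlane_image hM hM2ne
    rcases hpur with ⟨-, h⟩ | ⟨h, -⟩
    · exact hnot h
    · exact h hGwS
  · -- `G`-dozen is `D₋`: `G w` is an off-plane vector of `D₋`, not a slot, while `M(−G w)` is a slot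
    rw [hstd] at hGw_img
    have hnot := not_mem_fccSlots_of_offPlane_image hGw_img hne
    obtain ⟨w₀, hw₀, hGw₀⟩ := hGw_img
    have hM : basalMirror (-G w) ∈ fccSlots := by
      rw [← hGw₀, ← map_neg, basalMirror_basalMirror]; exact neg_mem_fccSlots (mem_coe.1 hw₀)
    rcases hpur with ⟨h, -⟩ | ⟨-, h⟩
    · exact hnot h
    · exact h hM

end Far

end Summit.Ventures.Crystal3D.Theorems

end
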